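import Summits.RiemannHypothesis.RiemannHypothesis.Theorems.PfPersistenceM2EvenSectorIndexComplete
import Summits.RiemannHypothesis.RiemannHypothesis.Theorems.WeilGroundStateGroundStatesConvergeToXiStubRealWitnessTight
import Summits.RiemannHypothesis.RiemannHypothesis.Theorems.WeilGroundStateGroundStatesConvergeToXiEvenWitnessParity
import HarnessLib

/-!
# PF-persistence, M2 seat (gen 6), part 6a: dividing a zero out of the transform of a compactly supported test
# (inside the same support interval), and a whole quadruple `e, ē, 1-e, 1-ē` while keeping EVEN and REAL

pub-rhpf cell, M2 seat, generation 6.  HONEST FRAMING (page 1 of everything in this cell): a long-odds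
MECHANISM SEARCH around Weil's quadratic functional; NOTHING here claims, approaches or conditionally proves RH.
Labels: PROVED = kernel-checked; CITED = in print; HYPOTHESIS = an explicit binder; DERIVED = paper level, NOT
kernel-checked.  Pure analysis, no zeta input.  Used by part 6b to identify part 4's hypothesis (QA_θ) with the
classical multiplier statement.

PROVED here (RH-free, [folklore]):
* `exists_divide_of_weilMellin_eq_zero` — DIVISION LEMMA: if `f̂(s₀) = 0` for a Weil test `f` supported in
  `[-b, b]` then `f̂(s) = (s₀ - s) ĝ(s)` for a Weil test `g` supported in `[-b, b]`
  (`g(t) = e^{-ct} ∫_{-b-1}^t e^{cu} f(u) du`, `c = s₀ - ½`, vanishes for `t > b` BECAUSE `∫ e^{cu} f = f̂(s₀) = 0`;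
  `f = g' + c g` and `(g')^(s) = -(s - ½) ĝ(s)`).
* `quadPoly e s = (s-e)(s-ē)(s-(1-e))(s-(1-ē))` with `quadPoly_conj`, `quadPoly_one_sub`, `quadPoly_ne_zero`
  (non-zero at `ρ ≠ e` in the open quadrant), `quadPoly_eq` (the form `(w²-λ²)(w²-λ̄²)`, `w = s - ½`, `λ = e - ½`).
* `exists_divide_quad`, `exists_evenReal_divide_quad` — for an EVEN REAL test with `f̂(e) = 0` (hence `= 0` at
  `ē, 1-e, 1-ē`): `f̂ = P_e · ĥ` with `h` again an even real test in `[-b, b]` (divide four times, then take the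
  even part of the real part; the identity persists since `P_e` has real coefficients and is even in `s - ½`).
Reused by name (tree, `GroundStatesConvergeToXi`): `realWitness_weilMellin_conj` (`(conj ∘ g)^(s) = conj ĝ(s̄)`),
`tsupport_comp_neg_subset_Icc`.
-/

noncomputable section

set_option linter.dupNamespace false

open Complex Filter Set MeasureTheory
open scoped Real Topology ComplexConjugate BigOperators ContDiff

namespace Summit.RiemannHypothesis.RiemannHypothesis.Theorems.PfPersistenceM2NegIndex

open Literature.NumberTheory.LFunctions
open Literature.NumberTheory.LFunctions.WeilConverse
open Literature.NumberTheory.LFunctions.ZetaZeros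
open Summit.RiemannHypothesis.RiemannHypothesis.Theorems.RuelleBandExactFirstBand (weilMellin_one_sub_of_even)
open Summit.RiemannHypothesis.RiemannHypothesis.Theorems.GroundStatesConvergeToXi
  (realWitness_weilMellin_conj tsupport_comp_neg_subset_Icc)

/-! ## L. Dividing out a zero of the transform inside the support interval -/

/-- **Division lemma.**  If `f̂(s₀) = 0` for a Weil test `f` supported in `[-b, b]`, then `f̂(s) = (s₀ - s) ĝ(s)`
for a Weil test `g` supported in `[-b, b]`: `g(t) = e^{-ct} ∫_{-b-1}^t e^{cu} f(u) du`, `c = s₀ - ½`, vanishes for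
`t > b` precisely because `∫ e^{cu} f = f̂(s₀) = 0`, and `f = g' + c g`. [folklore] -/
theorem exists_divide_of_weilMellin_eq_zero {f : ℝ → ℂ} (hf : IsWeilTest f) {b : ℝ}
    (hfs : tsupport f ⊆ Icc (-b) b) {s₀ : ℂ} (h0 : weilMellin f s₀ = 0) :
    ∃ g : ℝ → ℂ, IsWeilTest g ∧ tsupport g ⊆ Icc (-b) b ∧
      ∀ s : ℂ, weilMellin f s = (s₀ - s) * weilMellin g s := by
  set c : ℂ := s₀ - 1 / 2 with hc
  have hlin : ContDiff ℝ ∞ fun u : ℝ ↦ c * (u : ℂ) := contDiff_const.mul Complex.ofRealCLM.contDiff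
  set F : ℝ → ℂ := fun u ↦ f u * cexp (c * u) with hFdef
  have hFsmooth : ContDiff ℝ ∞ F := hf.1.mul hlin.cexp
  have hFcont : Continuous F := hFsmooth.continuous
  have hf0 : ∀ u : ℝ, u ∉ Icc (-b) b → f u = 0 := fun u hu ↦
    image_eq_zero_of_notMem_tsupport fun h ↦ hu (hfs h)
  have hF0 : ∀ u : ℝ, u ∉ Icc (-b) b → F u = 0 := fun u hu ↦ by simp [hFdef, hf0 u hu]
  set G : ℝ → ℂ := fun t ↦ ∫ u in (-b - 1)..t, F u with hGdef
  have hGd : ∀ t : ℝ, HasDerivAt G (F t) t := fun t ↦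
    (hFcont.integral_hasStrictDerivAt (-b - 1) t).hasDerivAt
  have hGderiv : deriv G = F := funext fun t ↦ (hGd t).deriv
  have hGsmooth : ContDiff ℝ ∞ G :=
    contDiff_infty_iff_deriv.2 ⟨fun t ↦ (hGd t).differentiableAt, by rw [hGderiv]; exact hFsmooth⟩
  have hGleft : ∀ t : ℝ, t < -b → G t = 0 := fun t ht ↦ by
    show ∫ u in (-b - 1)..t, F u = 0
    rw [intervalIntegral.integral_congr (g := fun _ ↦ (0 : ℂ)) fun u hu ↦ ?_, intervalIntegral.integral_zero]
    have hu' : u ≤ max (-b - 1) t := (Set.mem_uIcc.1 hu).elim (fun h ↦ h.2.trans (le_max_right _ _))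
      fun h ↦ h.2.trans (le_max_left _ _)
    have hub : u < -b := lt_of_le_of_lt hu' (max_lt (by linarith) ht)
    exact hF0 u fun h ↦ by linarith [h.1]
  have hGright : ∀ t : ℝ, b < t → G t = 0 := fun t ht ↦ by
    show ∫ u in (-b - 1)..t, F u = 0
    rw [intervalIntegral.integral_eq_integral_of_support_subset fun u hu ↦ ?_]
    · have h1 : ∫ u, F u = weilMellin f s₀ := by
        unfold weilMellin
        rfl
      rw [h1, h0]
    · have hu' : u ∈ Icc (-b) b := by_contra fun h ↦ hu (hF0 u h)
      exact ⟨by linarith [hu'.1], hu'.2.trans ht.le⟩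
  set g : ℝ → ℂ := fun t ↦ cexp (-(c * t)) * G t with hgdef
  have hgsmooth : ContDiff ℝ ∞ g := hlin.neg.cexp.mul hGsmooth
  have hg0 : ∀ t : ℝ, t ∉ Icc (-b) b → g t = 0 := fun t ht ↦ by
    by_cases h1 : t < -b
    · simp [hgdef, hGleft t h1]
    · have h2 : b < t := by
        by_contra h2
        exact ht ⟨not_lt.1 h1, not_lt.1 h2⟩
      simp [hgdef, hGright t h2]
  have hgsupp : Function.support g ⊆ Icc (-b) b := fun t ht ↦ by_contra fun h ↦ ht (hg0 t h)
  have hgts : tsupport g ⊆ Icc (-b) b := closure_minimal hgsupp isClosed_Icc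
  have hgc : HasCompactSupport g := isCompact_Icc.of_isClosed_subset (isClosed_tsupport _) hgts
  have hg : IsWeilTest g := ⟨hgsmooth, hgc⟩
  have hgd : ∀ t : ℝ, HasDerivAt g (-c * g t + f t) t := by
    intro t
    have h1 : HasDerivAt (fun t : ℝ ↦ -(c * (t : ℂ))) (-c) t := by
      have h := (Complex.ofRealCLM.hasDerivAt (x := t)).const_mul (-c)
      simpa [neg_mul] using h
    have h2 : HasDerivAt (fun t : ℝ ↦ cexp (-(c * t))) (cexp (-(c * t)) * -c) t :=
      (Complex.hasDerivAt_exp _).comp t h1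
    have h3 : HasDerivAt g (cexp (-(c * t)) * -c * G t + cexp (-(c * t)) * F t) t := h2.mul (hGd t)
    refine h3.congr_deriv ?_
    have hEE : cexp (-(c * t)) * cexp (c * t) = 1 := by
      rw [← Complex.exp_add]
      simp
    simp only [hgdef, hFdef]
    linear_combination (f t) * hEE
  have hf_eq : f = deriv g + fun t ↦ c * g t := by
    funext t
    simp only [Pi.add_apply, (hgd t).deriv]
    ring
  refine ⟨g, hg, hgts, fun s ↦ ?_⟩
  have hcm : IsWeilTest fun t ↦ c * g t := hg.const_mul c
  calc weilMellin f s = weilMellin (deriv g + fun t ↦ c * g t) s := by rw [← hf_eq]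
    _ = weilMellin (deriv g) s + c * weilMellin g s := by
        rw [weilMellin_add hg.deriv.1.continuous hg.deriv.2 hcm.1.continuous hcm.2, weilMellin_const_mul]
    _ = (s₀ - s) * weilMellin g s := by
        rw [weilMellin_deriv hg, hc]
        ring

/-! ## M. Dividing out a quadruple and re-symmetrising -/

/-- The quadruple polynomial of `e`: `P_e(s) = (s - e)(s - ē)(s - (1 - e))(s - (1 - ē))`. [folklore] -/
def quadPoly (e s : ℂ) : ℂ := (s - e) * ((s - conj e) * ((s - (1 - e)) * (s - (1 - conj e))))

/-- `P_e` in the variable `w = s - ½`: `(w² - λ²)(w² - λ̄²)`, `λ = e - ½`. [folklore] -/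
theorem quadPoly_eq (e s : ℂ) :
    quadPoly e s = ((s - 1 / 2) ^ 2 - (e - 1 / 2) ^ 2) * ((s - 1 / 2) ^ 2 - (conj e - 1 / 2) ^ 2) := by
  unfold quadPoly
  ring

/-- `P_e(s̄) = conj P_e(s)` (real coefficients). [folklore] -/
theorem quadPoly_conj (e s : ℂ) : quadPoly e (conj s) = conj (quadPoly e s) := by
  simp only [quadPoly, map_mul, map_sub, map_one, Complex.conj_conj]
  ring

/-- `P_e(1 - s) = P_e(s)` (even in `s - ½`). [folklore] -/
theorem quadPoly_one_sub (e s : ℂ) : quadPoly e (1 - s) = quadPoly e s := by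
  unfold quadPoly
  ring

/-- `P_e(ρ) ≠ 0` for `ρ ≠ e` in the open quadrant `Re > 1/2, Im > 0` (the other three roots lie outside it).
[folklore] -/
theorem quadPoly_ne_zero {e ρ : ℂ} (he : 1 / 2 < e.re ∧ 0 < e.im) (hρ : 1 / 2 < ρ.re ∧ 0 < ρ.im)
    (hne : ρ ≠ e) : quadPoly e ρ ≠ 0 := by
  unfold quadPoly
  refine mul_ne_zero (sub_ne_zero.2 hne) (mul_ne_zero ?_ (mul_ne_zero ?_ ?_)) <;> intro h <;>
    rw [sub_eq_zero] at h
  · have h1 := congrArg Complex.im h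
    simp at h1
    linarith [he.2, hρ.2]
  · have h1 := congrArg Complex.re h
    simp at h1
    linarith [he.1, hρ.1]
  · have h1 := congrArg Complex.re h
    simp at h1
    linarith [he.1, hρ.1]

/-- Dividing out the quadruple of `e`: for an even real test `f` in `[-b, b]` with `f̂(e) = 0` (hence `f̂ = 0` at
`ē, 1-e, 1-ē`) there is a test `g` in `[-b, b]` with `f̂ = P_e · ĝ`. [folklore] -/
theorem exists_divide_quad {f : ℝ → ℂ} (hf : IsWeilTest f) (heven : ∀ t : ℝ, f (-t) = f t)
    (hreal : ∀ t : ℝ, (f t).im = 0) {b : ℝ} (hfs : tsupport f ⊆ Icc (-b) b) {e : ℂ}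
    (he : 1 / 2 < e.re ∧ 0 < e.im) (h0 : weilMellin f e = 0) :
    ∃ g : ℝ → ℂ, IsWeilTest g ∧ tsupport g ⊆ Icc (-b) b ∧
      ∀ s : ℂ, weilMellin f s = quadPoly e s * weilMellin g s := by
  have hsym1 : ∀ s : ℂ, weilMellin f (conj s) = conj (weilMellin f s) := weilMellin_conj heven hreal
  have hsym2 : ∀ s : ℂ, weilMellin f (1 - s) = weilMellin f s := weilMellin_one_sub_of_even heven
  -- the pairwise differences of the four roots are non-zero
  have hd1 : e - conj e ≠ 0 := fun h ↦ by
    have h1 := congrArg Complex.im h; simp at h1; linarith [he.2]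
  have hd2 : e - (1 - e) ≠ 0 := fun h ↦ by
    have h1 := congrArg Complex.re h; simp at h1; linarith [he.1]
  have hd3 : conj e - (1 - e) ≠ 0 := fun h ↦ by
    have h1 := congrArg Complex.re h; simp at h1; linarith [he.1]
  have hd4 : e - (1 - conj e) ≠ 0 := fun h ↦ by
    have h1 := congrArg Complex.re h; simp at h1; linarith [he.1]
  have hd5 : conj e - (1 - conj e) ≠ 0 := fun h ↦ by
    have h1 := congrArg Complex.im h; simp at h1; linarith [he.2]
  have hd6 : 1 - e - (1 - conj e) ≠ 0 := fun h ↦ by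
    have h1 := congrArg Complex.im h; simp at h1; linarith [he.2]
  obtain ⟨g₁, hg₁, hg₁s, hg₁m⟩ := exists_divide_of_weilMellin_eq_zero hf hfs h0
  have h1 : weilMellin g₁ (conj e) = 0 := by
    have h := hg₁m (conj e)
    rw [hsym1, h0, map_zero] at h
    exact (mul_eq_zero.1 h.symm).resolve_left hd1
  obtain ⟨g₂, hg₂, hg₂s, hg₂m⟩ := exists_divide_of_weilMellin_eq_zero hg₁ hg₁s h1
  have h2 : weilMellin g₂ (1 - e) = 0 := by
    have h := hg₁m (1 - e)
    rw [hsym2, h0, hg₂m (1 - e)] at h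
    exact (mul_eq_zero.1 ((mul_eq_zero.1 h.symm).resolve_left hd2)).resolve_left hd3
  obtain ⟨g₃, hg₃, hg₃s, hg₃m⟩ := exists_divide_of_weilMellin_eq_zero hg₂ hg₂s h2
  have h3 : weilMellin g₃ (1 - conj e) = 0 := by
    have h := hg₁m (1 - conj e)
    have h' : weilMellin f (1 - conj e) = 0 := by
      rw [show (1 : ℂ) - conj e = conj (1 - e) by simp [map_sub], hsym1, hsym2, h0, map_zero]
    rw [h', hg₂m (1 - conj e), hg₃m (1 - conj e)] at h
    exact (mul_eq_zero.1 ((mul_eq_zero.1 ((mul_eq_zero.1 h.symm).resolve_left hd4)).resolve_left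
      hd5)).resolve_left hd6
  obtain ⟨g₄, hg₄, hg₄s, hg₄m⟩ := exists_divide_of_weilMellin_eq_zero hg₃ hg₃s h3
  refine ⟨g₄, hg₄, hg₄s, fun s ↦ ?_⟩
  rw [hg₁m s, hg₂m s, hg₃m s, hg₄m s]
  unfold quadPoly
  ring

/-- Dividing out the quadruple of `e` while keeping EVEN and REAL: symmetrise the quotient of
`exists_divide_quad` (`h = ` even part of `Re g`; the identity `P_e ĥ = f̂` persists because `P_e` has real
coefficients and is even in `s - ½`, and `f̂` has both symmetries). [folklore] -/
theorem exists_evenReal_divide_quad {f : ℝ → ℂ} (hf : IsWeilTest f) (heven : ∀ t : ℝ, f (-t) = f t)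
    (hreal : ∀ t : ℝ, (f t).im = 0) {b : ℝ} (hfs : tsupport f ⊆ Icc (-b) b) {e : ℂ}
    (he : 1 / 2 < e.re ∧ 0 < e.im) (h0 : weilMellin f e = 0) :
    ∃ h : ℝ → ℂ, IsWeilTest h ∧ (∀ t : ℝ, h (-t) = h t) ∧ (∀ t : ℝ, (h t).im = 0) ∧
      tsupport h ⊆ Icc (-b) b ∧ ∀ s : ℂ, weilMellin f s = quadPoly e s * weilMellin h s := by
  obtain ⟨g, hg, hgs, hgm⟩ := exists_divide_quad hf heven hreal hfs he h0
  have hsym1 : ∀ s : ℂ, weilMellin f (conj s) = conj (weilMellin f s) := weilMellin_conj heven hreal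
  have hsym2 : ∀ s : ℂ, weilMellin f (1 - s) = weilMellin f s := weilMellin_one_sub_of_even heven
  -- gc = conj ∘ g, h₁ = (g + gc)/2, h = (h₁ + h₁(-·))/2
  set gc : ℝ → ℂ := fun t ↦ conj (g t) with hgcdef
  have hgct : IsWeilTest gc := by
    refine ⟨?_, hg.2.comp_left (g := fun z : ℂ ↦ conj z) (map_zero _)⟩
    have h := (Complex.conjCLE.contDiff (n := ∞)).comp hg.1
    simpa [Function.comp_def] using h
  have hgcs : tsupport gc ⊆ Icc (-b) b := (tsupport_comp_subset (g := fun z : ℂ ↦ conj z) (map_zero _) g).trans hgs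
  set h₁ : ℝ → ℂ := fun t ↦ (1 / 2 : ℂ) * (g + gc) t with hh₁def
  have hh₁t : IsWeilTest h₁ := (hg.add hgct).const_mul _
  have hh₁s : tsupport h₁ ⊆ Icc (-b) b :=
    tsupport_mul_subset_right.trans ((tsupport_add g gc).trans (union_subset hgs hgcs))
  have hh₁r : ∀ t : ℝ, (h₁ t).im = 0 := fun t ↦ by
    simp [hh₁def, hgcdef, Complex.mul_im, Complex.add_im, Complex.conj_im]
  have hh₁m : ∀ s : ℂ, weilMellin h₁ s = 1 / 2 * (weilMellin g s + conj (weilMellin g (conj s))) := fun s ↦ by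
    rw [hh₁def, weilMellin_const_mul, weilMellin_add hg.1.continuous hg.2 hgct.1.continuous hgct.2,
      realWitness_weilMellin_conj]
  -- `P_e ĥ₁ = f̂`
  have hkey₁ : ∀ s : ℂ, quadPoly e s * weilMellin h₁ s = weilMellin f s := fun s ↦ by
    have ha : quadPoly e s * weilMellin g s = weilMellin f s := (hgm s).symm
    have hb : quadPoly e s * conj (weilMellin g (conj s)) = weilMellin f s := by
      have h := hgm (conj s)
      rw [hsym1, quadPoly_conj] at h
      have h' := congrArg conj h
      rw [Complex.conj_conj, map_mul, Complex.conj_conj] at h'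
      exact h'.symm
    rw [hh₁m]
    linear_combination (1 / 2 : ℂ) * ha + (1 / 2 : ℂ) * hb
  set h : ℝ → ℂ := fun t ↦ (1 / 2 : ℂ) * (h₁ + fun t ↦ h₁ (-t)) t with hhdef
  have hh₁n : IsWeilTest fun t ↦ h₁ (-t) := hh₁t.comp_neg
  have hht : IsWeilTest h := (hh₁t.add hh₁n).const_mul _
  have hhm : ∀ s : ℂ, weilMellin h s = 1 / 2 * (weilMellin h₁ s + weilMellin h₁ (1 - s)) := fun s ↦ by
    rw [hhdef, weilMellin_const_mul, weilMellin_add hh₁t.1.continuous hh₁t.2 hh₁n.1.continuous hh₁n.2,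
      weilMellin_comp_neg]
  refine ⟨h, hht, fun t ↦ ?_, fun t ↦ ?_, ?_, fun s ↦ ?_⟩
  · simp only [hhdef, Pi.add_apply, neg_neg]
    ring
  · simp [hhdef, Complex.mul_im, Complex.add_im, hh₁r]
  · exact tsupport_mul_subset_right.trans
      ((tsupport_add _ _).trans (union_subset hh₁s (tsupport_comp_neg_subset_Icc hh₁s)))
  · have ha := hkey₁ s
    have hb : quadPoly e s * weilMellin h₁ (1 - s) = weilMellin f s := by
      rw [← quadPoly_one_sub e s, hkey₁ (1 - s), hsym2]
    rw [hhm]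
    linear_combination (-(1 / 2 : ℂ)) * ha - (1 / 2 : ℂ) * hb

end Summit.RiemannHypothesis.RiemannHypothesis.Theorems.PfPersistenceM2NegIndex

end
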